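import Summits.HodgeConjecture.CorCM.IrreducibleOddWeightsIndexParityTwistedPair
import HarnessLib

/-!
# Index parity, IX (CM fields): TWISTED × TWISTED IS ADDITIVE **IFF** THE TWO PIVOT IMAGES MEET IN A REAL FIELD — the
# converse: a non-real common element of `y₀(T₀)` and `y₁(T₁)` produces an explicit common matrix coefficient

COR-CM (cell `pub-hodgecm2`, binder seat `b16` gen 68, count-neutral claim INDEX PARITY, file P8; theorems only, no
definition, no named fact, no `sorry`).  NEW as stated, hence under `Summits/`.  HONEST FRAMING: Galois theory of CM fields
inside `ℂ` with consequences for `dim MT(A₀ × A₁)` of abelian varieties with complex multiplication; nothing is claimed about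
the algebraicity of Hodge classes; `HC_CM` is neither used nor asserted.

SETTING (P7 `…IndexParityTwistedPair`).  `T₀ ⊆ K_{i₀}`, `T₁ ⊆ K_{i₁}` containing the traces, twisted types at `y₀`, `y₁`.
P7: `y₀(T₀) ∩ y₁(T₁) ⊂ ℝ` ⟹ additive.  HERE the converse: if some `z₀ = y₀(t₀) ∈ y₁(T₁)` is NOT real, the function
`c(g) = [g z₀ = z₀] − [conj(g z₀) = z₀]` on `Aut(ℂ)` is left-invariant under both stabilisers (they fix `z₀`), left-odd (every
automorphism of `ℂ` commutes with conjugation on the CM field `y₀(T₀)`, P3 `smul_conj_smul_restrict`) and non-zero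
(`c(1) = 1`), hence a non-zero element of the defect space (P7 `mem_twistedShadowCoeff_inf_twistedShadowCoeff_iff`):

* `twistedWitness_mem_inf` — the witness lies in `S(w₀) ∩ S(w₁)`; `twistedWitness_ne_zero`.
* **`cmFamilyRank_add_card_lt_of_twisted_pair_of_not_real`** — the twisted pair INTERACTS:
  `cmFamilyRank Φ + 2 < cmTypeRank Φ₀ + cmTypeRank Φ₁ + 1`, i.e. `Hg(A^{(y₀)} × A^{(y₁)}) ⊊ Hg(A^{(y₀)}) × Hg(A^{(y₁)})`.
* **`cmFamilyRank_add_card_eq_iff_of_twisted_pair`** — with P7: **ADDITIVE ⟺ every element of `y₀(T₀) ∩ y₁(T₁)` is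
  real** — an exact, type-free-looking criterion for this pair of (degenerate) types, decided by the two embeddings alone.

## References

* [Lang2002] S. Lang, *Algebra*, 3rd ed., VI §1 Thm. 1.1, Cor. 1.6, Thm. 1.12, V §2 Thm. 2.8.
* [Gordon1999HodgeAVSurvey] B. B. Gordon, *A survey of the Hodge conjecture for abelian varieties*, §3 Theorem, 7.5–7.7.
* [Shimura1998] G. Shimura, *Abelian Varieties with Complex Multiplication and Modular Functions*, §18.1, §18.2 Lemma (i).
-/

set_option autoImplicit false

noncomputable section

open scoped BigOperators Classical

open CategoryTheory CategoryTheory.Limits NumberField Module IntermediateField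

namespace Summit.HodgeConjecture.CorCM

open Literature.NumberTheory.ComplexMultiplication
open Literature.AlgebraicGeometry.Motives (AbelianVariety CMType)
open Literature.AlgebraicGeometry.Pohlmann1968

section TwistedPairExact

variable {I : Type} [Fintype I] {K : I → Type} [∀ i, Field (K i)] [∀ i, NumberField (K i)] [∀ i, IsCMField (K i)]
  {T₀ : Type} [Field T₀] [NumberField T₀] {T₁ : Type} [Field T₁] [NumberField T₁]

omit [Fintype I] [NumberField T₀] [NumberField T₁] in
/-- On the image of a subfield of a CM field every automorphism of `ℂ` commutes with conjugation:
`g(conj(y₀ t)) = conj(g(y₀ t))` (P3 `smul_conj_smul_restrict`, evaluated). [cite: Shimura1998, §18.2 Lemma (i)] -/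
theorem apply_conj_apply_eq {i₀ : I} [Algebra T₀ (K i₀)] (g : ℂ ≃+* ℂ) (y₀ : T₀ →+* ℂ) (t : T₀) :
    g (starRingEnd ℂ (y₀ t)) = starRingEnd ℂ (g (y₀ t)) := by
  have h := RingHom.congr_fun (smul_conj_smul_restrict (K i₀) g y₀) t
  simpa only [ringEquiv_smul_apply, starRingAut_apply, starRingEnd_apply] using h

omit [Fintype I] in
/-- **THE WITNESS LIES IN THE DEFECT SPACE**: for `z₀ = y₀(t₀) = y₁(t₁)`, the function
`c(g) = [g z₀ = z₀] − [conj(g z₀) = z₀]` (`= [g⁻¹z₀ = z₀] − [g⁻¹z₀ = z̄₀]`) is left-invariant under both stabilisers and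
left-odd, so it belongs to `S(w₀) ∩ S(w₁)` for the twisted shadows at `y₀`, `y₁`. [cite: Lang2002, VI §1 Thm. 1.1]
[cite: Shimura1998, §18.1] -/
theorem twistedWitness_mem_inf {i₀ i₁ : I} (Φ : ∀ i, CMType (K i)) [Algebra T₀ (K i₀)] [Algebra T₁ (K i₁)]
    (y₀ : T₀ →+* ℂ) (y₁ : T₁ →+* ℂ)
    (htw₀ : ∀ y : T₀ →+* ℂ,
      ∑ t ∈ Finset.univ.filter (fun t : K i₀ →+* ℂ => t.comp (algebraMap T₀ (K i₀)) = y),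
          antiVec (Φ i₀).1 (1 : ℂ ≃+* ℂ) t =
        (Module.finrank T₀ (K i₀) : ℚ) *
          ((if y = y₀ then 1 else 0) - (if y = (starRingAut : ℂ ≃+* ℂ) • y₀ then 1 else 0)))
    (htw₁ : ∀ y : T₁ →+* ℂ,
      ∑ t ∈ Finset.univ.filter (fun t : K i₁ →+* ℂ => t.comp (algebraMap T₁ (K i₁)) = y),
          antiVec (Φ i₁).1 (1 : ℂ ≃+* ℂ) t =
        (Module.finrank T₁ (K i₁) : ℚ) *
          ((if y = y₁ then 1 else 0) - (if y = (starRingAut : ℂ ≃+* ℂ) • y₁ then 1 else 0)))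
    {t₀ : T₀} {t₁ : T₁} (ht : y₀ t₀ = y₁ t₁) :
    (fun g : ℂ ≃+* ℂ => (if g (y₀ t₀) = y₀ t₀ then (1 : ℚ) else 0) -
        (if starRingEnd ℂ (g (y₀ t₀)) = y₀ t₀ then 1 else 0)) ∈
      Submodule.span ℚ (Set.range fun y : T₀ →+* ℂ => fun g : ℂ ≃+* ℂ =>
          ∑ t ∈ Finset.univ.filter (fun t : K i₀ →+* ℂ => t.comp (algebraMap T₀ (K i₀)) = g • y),
            antiVec (Φ i₀).1 (1 : ℂ ≃+* ℂ) t) ⊓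
        Submodule.span ℚ (Set.range fun y : T₁ →+* ℂ => fun g : ℂ ≃+* ℂ =>
          ∑ t ∈ Finset.univ.filter (fun t : K i₁ →+* ℂ => t.comp (algebraMap T₁ (K i₁)) = g • y),
            antiVec (Φ i₁).1 (1 : ℂ ≃+* ℂ) t) := by
  rw [mem_twistedShadowCoeff_inf_twistedShadowCoeff_iff Φ y₀ y₁ htw₀ htw₁]
  -- an automorphism fixing `y₀` (or `y₁`) fixes `z₀`, and then `h u = z₀ ↔ u = z₀`
  have key : ∀ h : ℂ ≃+* ℂ, h (y₀ t₀) = y₀ t₀ → ∀ g : ℂ ≃+* ℂ,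
      ((if (h * g) (y₀ t₀) = y₀ t₀ then (1 : ℚ) else 0) -
          (if starRingEnd ℂ ((h * g) (y₀ t₀)) = y₀ t₀ then 1 else 0)) =
        (if g (y₀ t₀) = y₀ t₀ then (1 : ℚ) else 0) - (if starRingEnd ℂ (g (y₀ t₀)) = y₀ t₀ then 1 else 0) := by
    intro h hh g
    have hinj : ∀ u : ℂ, h u = y₀ t₀ ↔ u = y₀ t₀ := fun u => by
      constructor
      · intro hu; exact h.injective (hu.trans hh.symm)
      · rintro rfl; exact hh
    -- `conj(h w) = h(conj w)` for `w = g(y₀ t₀) = (g • y₀)(t₀)` in the image of an embedding of `T₀`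
    have hcomm : starRingEnd ℂ (h (g (y₀ t₀))) = h (starRingEnd ℂ (g (y₀ t₀))) := by
      have := apply_conj_apply_eq (K := K) (i₀ := i₀) h (g • y₀) t₀
      rw [ringEquiv_smul_apply] at this
      exact this.symm
    rw [RingAut.mul_apply, hcomm]
    simp only [hinj]
  refine ⟨fun h hh g => key h ?_ g, fun h hh g => key h ?_ g, fun g => ?_⟩
  · have := RingHom.congr_fun hh t₀
    rwa [ringEquiv_smul_apply] at this
  · have := RingHom.congr_fun hh t₁
    rw [ringEquiv_smul_apply, ← ht] at this
    exact this
  · -- oddness: `(ρg) z₀ = conj(g z₀)` and `conj conj = id`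
    rw [RingAut.mul_apply, starRingAut_apply, ← starRingEnd_apply, starRingEnd_self_apply]
    ring

/-- **TWISTED × TWISTED WITH A NON-REAL COMMON ELEMENT INTERACTS**: if some `y₀(t₀) = y₁(t₁)` is not real, then
`cmFamilyRank Φ + 2 < cmTypeRank Φ₀ + cmTypeRank Φ₁ + 1` — `Hg(A^{(y₀)} × A^{(y₁)}) ≠ Hg(A^{(y₀)}) × Hg(A^{(y₁)})`.
[cite: Gordon1999HodgeAVSurvey, §3 Theorem, 7.5–7.7] [cite: Lang2002, VI §1 Thm. 1.12] -/
theorem cmFamilyRank_add_card_lt_of_twisted_pair_of_not_real {i₀ i₁ : I} (h01 : i₀ ≠ i₁) (hI : ∀ l, l = i₀ ∨ l = i₁)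
    (Φ : ∀ i, CMType (K i)) [Algebra T₀ (K i₀)] [Algebra T₁ (K i₁)]
    (htr₀ : ∀ (a : K i₀ →+* ℂ) (k : K i₀), a k ∈ normalClosure ℚ (K i₁) ℂ → k ∈ Set.range (algebraMap T₀ (K i₀)))
    (htr₁ : ∀ (b : K i₁ →+* ℂ) (k : K i₁), b k ∈ normalClosure ℚ (K i₀) ℂ → k ∈ Set.range (algebraMap T₁ (K i₁)))
    (y₀ : T₀ →+* ℂ) (y₁ : T₁ →+* ℂ)
    (htw₀ : ∀ y : T₀ →+* ℂ,
      ∑ t ∈ Finset.univ.filter (fun t : K i₀ →+* ℂ => t.comp (algebraMap T₀ (K i₀)) = y),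
          antiVec (Φ i₀).1 (1 : ℂ ≃+* ℂ) t =
        (Module.finrank T₀ (K i₀) : ℚ) *
          ((if y = y₀ then 1 else 0) - (if y = (starRingAut : ℂ ≃+* ℂ) • y₀ then 1 else 0)))
    (htw₁ : ∀ y : T₁ →+* ℂ,
      ∑ t ∈ Finset.univ.filter (fun t : K i₁ →+* ℂ => t.comp (algebraMap T₁ (K i₁)) = y),
          antiVec (Φ i₁).1 (1 : ℂ ≃+* ℂ) t =
        (Module.finrank T₁ (K i₁) : ℚ) *
          ((if y = y₁ then 1 else 0) - (if y = (starRingAut : ℂ ≃+* ℂ) • y₁ then 1 else 0)))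
    {t₀ : T₀} {t₁ : T₁} (ht : y₀ t₀ = y₁ t₁) (hnr : starRingEnd ℂ (y₀ t₀) ≠ y₀ t₀) :
    CMAlgebra.cmFamilyRank Φ + Fintype.card I < (∑ i, cmTypeRank (Φ i)) + 1 := by
  have hcard : Fintype.card I = 2 := by
    rw [← Finset.card_univ, show (Finset.univ : Finset I) = {i₀, i₁} from Finset.ext fun j => by
      simpa only [Finset.mem_univ, Finset.mem_insert, Finset.mem_singleton, true_iff] using hI j,
      Finset.card_pair h01]
  have hpair := cmTypeRank_add_cmTypeRank_eq_cmFamilyRank_add_one_add_finrank_shadow_inf_shadow h01 hI Φ htr₀ htr₁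
  set S := Submodule.span ℚ (Set.range fun y : T₀ →+* ℂ => fun g : ℂ ≃+* ℂ =>
          ∑ t ∈ Finset.univ.filter (fun t : K i₀ →+* ℂ => t.comp (algebraMap T₀ (K i₀)) = g • y),
            antiVec (Φ i₀).1 (1 : ℂ ≃+* ℂ) t) ⊓
        Submodule.span ℚ (Set.range fun y : T₁ →+* ℂ => fun g : ℂ ≃+* ℂ =>
          ∑ t ∈ Finset.univ.filter (fun t : K i₁ →+* ℂ => t.comp (algebraMap T₁ (K i₁)) = g • y),
            antiVec (Φ i₁).1 (1 : ℂ ≃+* ℂ) t) with hS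
  have hmem := twistedWitness_mem_inf Φ y₀ y₁ htw₀ htw₁ ht
  -- the witness is non-zero at `g = 1`
  have hne : (fun g : ℂ ≃+* ℂ => (if g (y₀ t₀) = y₀ t₀ then (1 : ℚ) else 0) -
      (if starRingEnd ℂ (g (y₀ t₀)) = y₀ t₀ then 1 else 0)) ≠ 0 := by
    intro h0
    have := congrFun h0 1
    simp only [RingAut.one_apply, if_true, Pi.zero_apply, if_neg hnr] at this
    norm_num at this
  haveI : Module.Finite ℚ (Submodule.span ℚ (Set.range fun y : T₀ →+* ℂ => fun g : ℂ ≃+* ℂ =>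
      ∑ t ∈ Finset.univ.filter (fun t : K i₀ →+* ℂ => t.comp (algebraMap T₀ (K i₀)) = g • y),
        antiVec (Φ i₀).1 (1 : ℂ ≃+* ℂ) t)) := Module.Finite.span_of_finite ℚ (Set.finite_range _)
  haveI : Module.Finite ℚ S := Module.Finite.of_injective (Submodule.inclusion inf_le_left) (Submodule.inclusion_injective _)
  have hpos : 0 < Module.finrank ℚ S :=
    Module.finrank_pos_iff_exists_ne_zero.2 ⟨⟨_, hmem⟩, fun h0 => hne (by simpa using congrArg Subtype.val h0)⟩
  rw [IrrOdd.sum_eq_add_of_pair _ hI h01, hcard]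
  omega

/-- **TWISTED × TWISTED: ADDITIVE ⟺ THE TWO PIVOT IMAGES MEET IN A REAL FIELD** (P7 + the converse above):
`Hg(A^{(y₀)} × A^{(y₁)}) = Hg(A^{(y₀)}) × Hg(A^{(y₁)})` iff every common element of `y₀(T₀)` and `y₁(T₁)` is real.
[cite: Lang2002, VI §1 Thm. 1.12] [cite: Gordon1999HodgeAVSurvey, §3 Theorem, 7.5–7.7] -/
theorem cmFamilyRank_add_card_eq_iff_of_twisted_pair {i₀ i₁ : I} (h01 : i₀ ≠ i₁) (hI : ∀ l, l = i₀ ∨ l = i₁)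
    (Φ : ∀ i, CMType (K i)) [Algebra T₀ (K i₀)] [Algebra T₁ (K i₁)]
    (htr₀ : ∀ (a : K i₀ →+* ℂ) (k : K i₀), a k ∈ normalClosure ℚ (K i₁) ℂ → k ∈ Set.range (algebraMap T₀ (K i₀)))
    (htr₁ : ∀ (b : K i₁ →+* ℂ) (k : K i₁), b k ∈ normalClosure ℚ (K i₀) ℂ → k ∈ Set.range (algebraMap T₁ (K i₁)))
    (y₀ : T₀ →+* ℂ) (y₁ : T₁ →+* ℂ)
    (htw₀ : ∀ y : T₀ →+* ℂ,
      ∑ t ∈ Finset.univ.filter (fun t : K i₀ →+* ℂ => t.comp (algebraMap T₀ (K i₀)) = y),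
          antiVec (Φ i₀).1 (1 : ℂ ≃+* ℂ) t =
        (Module.finrank T₀ (K i₀) : ℚ) *
          ((if y = y₀ then 1 else 0) - (if y = (starRingAut : ℂ ≃+* ℂ) • y₀ then 1 else 0)))
    (htw₁ : ∀ y : T₁ →+* ℂ,
      ∑ t ∈ Finset.univ.filter (fun t : K i₁ →+* ℂ => t.comp (algebraMap T₁ (K i₁)) = y),
          antiVec (Φ i₁).1 (1 : ℂ ≃+* ℂ) t =
        (Module.finrank T₁ (K i₁) : ℚ) *
          ((if y = y₁ then 1 else 0) - (if y = (starRingAut : ℂ ≃+* ℂ) • y₁ then 1 else 0))) :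
    CMAlgebra.cmFamilyRank Φ + Fintype.card I = (∑ i, cmTypeRank (Φ i)) + 1 ↔
      ∀ z : ℂ, z ∈ y₀.toRatAlgHom.fieldRange → z ∈ y₁.toRatAlgHom.fieldRange → starRingEnd ℂ z = z := by
  constructor
  · intro hadd z hz₀ hz₁
    by_contra hnr
    obtain ⟨t₀, rfl⟩ := AlgHom.mem_fieldRange.1 hz₀
    obtain ⟨t₁, ht₁⟩ := AlgHom.mem_fieldRange.1 hz₁
    have hlt := cmFamilyRank_add_card_lt_of_twisted_pair_of_not_real h01 hI Φ htr₀ htr₁ y₀ y₁ htw₀ htw₁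
      (t₀ := t₀) (t₁ := t₁) (by exact ht₁.symm) hnr
    omega
  · exact cmFamilyRank_add_card_eq_of_twisted_pair_of_real h01 hI Φ htr₀ htr₁ y₀ y₁ htw₀ htw₁

end TwistedPairExact

end Summit.HodgeConjecture.CorCM

end
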